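import Literature.RingTheory.Etale.IndEtaleFactorization
import Mathlib.RingTheory.LocalRing.ResidueField.Ideal
import Mathlib.RingTheory.Localization.Away.Basic
import HarnessLib

/-!
# The constructible localization of a ring (w-localization, light form)

For a commutative ring `A`, Bhatt–Scholze (after Stacks Project, Tags 096U–0975) construct a
faithfully flat ind-Zariski `A`-algebra `A_w = colim_E ∏_{E = E' ⊔ E''} A~_{Z(E',E'')}` indexed by
finite subsets `E ⊆ A` and their sign patterns, where `Z(E', E'') = ⋂_{f ∈ E'} D(f) ∩ ⋂_{f ∈ E''} V(f)`
is a stratum of `Spec A` and `A~_Z = S⁻¹A` for `S` the elements of `A` invertible on `Z` (Stacks,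
Tag 096V). Its closed points form a copy of `Spec A` with the constructible topology and
`A_w / I ≅ colim_E ∏ Γ(Z(E',E''), 𝒪)` is an absolutely flat (von Neumann regular) ring.

We formalize exactly the part of this used in the proof of Theorem 2.3.4 (no w-locality):

* `CLoc A` — the `A`-algebra `colim_E ∏_{c : E → Bool} S_{E,c}⁻¹ A` (`clSubmonoid`,
  `clStage`, `clTransition`), satisfying the ind-étale factorization criterion
  (`CLoc.factorsEtale`; it is ind-Zariski);
* `CQuot A` — the constructible quotient `colim_E ∏_c Γ(Z(E,c), 𝒪)` with the surjection
  `CLoc.toCQuot` and its kernel `CLoc.ideal A`;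
* `CQuot.vonNeumannRegular` — every element `x` of `CQuot A` satisfies `x = x * y * x` for some
  `y` (Stacks, Tag 0975 (4) in substance); hence `CLoc.isMaximal_of_ideal_le` — **every prime of
  `CLoc A` containing `CLoc.ideal A` is maximal**;
* `CLoc.exists_prime_over` — **every prime of `A` lies under a prime of `CLoc A` containing the
  ideal** (Stacks, Tag 0975 (2): the closed subscheme surjects onto `Spec A`).

## References

* The Stacks Project, Tags 096U, 096V, 0975. [StacksProject]
* B. Bhatt, P. Scholze, *The pro-étale topology for schemes*, Astérisque 369 (2015), §2.1–2.2
  (w-localization). [BhattScholze2015]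

## Design notes

* Strata of a finite `E ⊆ A` are indexed by sign patterns `c : E → Bool` (`true` = invertible,
  `false` = zero); restriction of patterns along `E₁ ⊆ E₂` is definitionally functorial, which
  keeps the directed system strict.
* Everything is an `A`-algebra and all maps are `A`-algebra maps; uniqueness of maps out of
  quotients and localizations gives all compatibilities.
-/

universe u

namespace Literature.RingTheory.Localization

open Literature.RingTheory.Etale

variable (A : Type u) [CommRing A]

/-! ### Strata -/

namespace CLoc

variable {A}

/-- The inclusion of index types along `E₁ ⊆ E₂`. [folklore] -/
abbrev incl {E₁ E₂ : Finset A} (h : E₁ ⊆ E₂) (e : E₁) : E₂ := ⟨e.1, h e.2⟩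

/-- The elements of `E` declared invertible by the sign pattern `c`. [folklore] -/
def posPart (E : Finset A) (c : E → Bool) : Finset A :=
  (E.attach.filter fun e => c e = true).map (Function.Embedding.subtype _)

/-- The elements of `E` declared zero by the sign pattern `c`. [folklore] -/
def negPart (E : Finset A) (c : E → Bool) : Finset A :=
  (E.attach.filter fun e => c e = false).map (Function.Embedding.subtype _)

omit [CommRing A] in
/-- Membership in `posPart`. [folklore] -/
theorem mem_posPart {E : Finset A} {c : E → Bool} {a : A} :
    a ∈ posPart E c ↔ ∃ h : a ∈ E, c ⟨a, h⟩ = true := by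
  constructor
  · rintro ha
    obtain ⟨e, he, rfl⟩ := Finset.mem_map.1 ha
    exact ⟨e.2, (Finset.mem_filter.1 he).2⟩
  · rintro ⟨ha, hc⟩
    exact Finset.mem_map.2 ⟨⟨a, ha⟩, Finset.mem_filter.2 ⟨Finset.mem_attach _ _, hc⟩, rfl⟩

omit [CommRing A] in
/-- Membership in `negPart`. [folklore] -/
theorem mem_negPart {E : Finset A} {c : E → Bool} {a : A} :
    a ∈ negPart E c ↔ ∃ h : a ∈ E, c ⟨a, h⟩ = false := by
  constructor
  · rintro ha
    obtain ⟨e, he, rfl⟩ := Finset.mem_map.1 ha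
    exact ⟨e.2, (Finset.mem_filter.1 he).2⟩
  · rintro ⟨ha, hc⟩
    exact Finset.mem_map.2 ⟨⟨a, ha⟩, Finset.mem_filter.2 ⟨Finset.mem_attach _ _, hc⟩, rfl⟩

omit [CommRing A] in
/-- `posPart` grows along `E₁ ⊆ E₂`. [folklore] -/
theorem posPart_mono {E₁ E₂ : Finset A} (h : E₁ ⊆ E₂) (c : E₂ → Bool) :
    posPart E₁ (c ∘ incl h) ⊆ posPart E₂ c := by
  intro a ha
  obtain ⟨ha, hc⟩ := mem_posPart.1 ha
  exact mem_posPart.2 ⟨h ha, hc⟩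

omit [CommRing A] in
/-- `negPart` grows along `E₁ ⊆ E₂`. [folklore] -/
theorem negPart_mono {E₁ E₂ : Finset A} (h : E₁ ⊆ E₂) (c : E₂ → Bool) :
    negPart E₁ (c ∘ incl h) ⊆ negPart E₂ c := by
  intro a ha
  obtain ⟨ha, hc⟩ := mem_negPart.1 ha
  exact mem_negPart.2 ⟨h ha, hc⟩

/-- The ideal of the stratum `Z(E, c)`: generated by the elements declared zero. [folklore] -/
def strIdeal (E : Finset A) (c : E → Bool) : Ideal A := Ideal.span (negPart E c : Set A)

/-- The element inverted on the stratum `Z(E, c)`: the product of the elements declared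
invertible. [folklore] -/
def strElem (E : Finset A) (c : E → Bool) : A := ∏ e ∈ posPart E c, e

/-- The stratum ideals grow along `E₁ ⊆ E₂`. [folklore] -/
theorem strIdeal_mono {E₁ E₂ : Finset A} (h : E₁ ⊆ E₂) (c : E₂ → Bool) :
    strIdeal E₁ (c ∘ incl h) ≤ strIdeal E₂ c :=
  Ideal.span_mono (Finset.coe_subset.2 (negPart_mono h c))

/-- The inverted elements divide along `E₁ ⊆ E₂`. [folklore] -/
theorem strElem_dvd {E₁ E₂ : Finset A} (h : E₁ ⊆ E₂) (c : E₂ → Bool) :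
    strElem E₁ (c ∘ incl h) ∣ strElem E₂ c :=
  Finset.prod_dvd_prod_of_subset _ _ _ (posPart_mono h c)

/-- The coordinate ring `Γ(Z(E,c), 𝒪) = (A / (negPart)) [1 / ∏ posPart]` of the stratum.
[cite: StacksProject, Tag 096V] -/
abbrev StrRing (E : Finset A) (c : E → Bool) : Type u :=
  Localization.Away (Ideal.Quotient.mk (strIdeal E c) (strElem E c))

/-- The multiplicative set of elements of `A` invertible on the stratum `Z(E, c)`.
[cite: StacksProject, Tag 096V] -/
def clSubmonoid (E : Finset A) (c : E → Bool) : Submonoid A :=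
  (IsUnit.submonoid (StrRing E c)).comap (algebraMap A (StrRing E c))

/-- Membership in `clSubmonoid`. [folklore] -/
theorem mem_clSubmonoid {E : Finset A} {c : E → Bool} {s : A} :
    s ∈ clSubmonoid E c ↔ IsUnit (algebraMap A (StrRing E c) s) := Iff.rfl

/-- The local ring of the stratum `A~_{Z(E,c)} = S_{E,c}⁻¹ A`. [cite: StacksProject, Tag 096V] -/
abbrev StrLoc (E : Finset A) (c : E → Bool) : Type u := Localization (clSubmonoid E c)

/-- `S_{E,c}⁻¹ A → Γ(Z(E,c), 𝒪)` (the elements of `S` are invertible there by definition).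
[cite: StacksProject, Tag 096V] -/
noncomputable def strLocToRing (E : Finset A) (c : E → Bool) : StrLoc E c →ₐ[A] StrRing E c :=
  IsLocalization.liftAlgHom (M := clSubmonoid E c) (f := Algebra.ofId A (StrRing E c)) fun s => s.2

/-- `S⁻¹A → Γ(Z, 𝒪)` is surjective (`Γ(Z, 𝒪)` is generated by `A` and the inverse of the inverted
element, which lies in `S`). [cite: StacksProject, Tag 096V] -/
theorem strLocToRing_surjective (E : Finset A) (c : E → Bool) :
    Function.Surjective (strLocToRing E c) := by
  intro q
  obtain ⟨⟨b, s⟩, hq⟩ :=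
    IsLocalization.surj (Submonoid.powers (Ideal.Quotient.mk (strIdeal E c) (strElem E c))) q
  obtain ⟨n, hn⟩ := (Submonoid.mem_powers_iff _ _).1 s.2
  obtain ⟨a, rfl⟩ := Ideal.Quotient.mk_surjective b
  have hs : strElem E c ^ n ∈ clSubmonoid E c := by
    rw [mem_clSubmonoid, map_pow, IsScalarTower.algebraMap_apply A (A ⧸ strIdeal E c) (StrRing E c)]
    exact (IsLocalization.Away.algebraMap_isUnit _).pow n
  refine ⟨IsLocalization.mk' (StrLoc E c) a ⟨strElem E c ^ n, hs⟩, ?_⟩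
  rw [strLocToRing, IsLocalization.coe_liftAlgHom, IsLocalization.lift_mk'_spec]
  change algebraMap A (StrRing E c) a = algebraMap A (StrRing E c) (strElem E c ^ n) * q
  rw [IsScalarTower.algebraMap_apply A (A ⧸ strIdeal E c) (StrRing E c) a,
    IsScalarTower.algebraMap_apply A (A ⧸ strIdeal E c) (StrRing E c), map_pow,
    Ideal.Quotient.algebraMap_eq, hn, mul_comm]
  exact hq.symm

/-! ### Uniqueness of `A`-algebra maps out of localizations of `A` -/

/-- Two `A`-algebra maps out of a localization of `A` coincide. [folklore] -/
theorem algHom_ext_of_isLocalization {S : Submonoid A} {L T : Type*} [CommRing L] [Algebra A L]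
    [IsLocalization S L] [CommRing T] [Algebra A T] (f g : L →ₐ[A] T) : f = g :=
  AlgHom.coe_ringHom_injective (IsLocalization.ringHom_ext S (by rw [f.comp_algebraMap, g.comp_algebraMap]))

/-- Two `A`-algebra maps out of a localization of a quotient of `A` coincide. [folklore] -/
theorem algHom_ext_of_isLocalization_quotient {J : Ideal A} {S : Submonoid (A ⧸ J)} {L T : Type*}
    [CommRing L] [Algebra (A ⧸ J) L] [Algebra A L] [IsScalarTower A (A ⧸ J) L] [IsLocalization S L]
    [CommRing T] [Algebra A T] (f g : L →ₐ[A] T) : f = g := by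
  apply AlgHom.coe_ringHom_injective
  refine IsLocalization.ringHom_ext S ?_
  refine Ideal.Quotient.ringHom_ext ?_
  ext a
  change f (algebraMap (A ⧸ J) L (algebraMap A (A ⧸ J) a)) = g (algebraMap (A ⧸ J) L (algebraMap A (A ⧸ J) a))
  rw [← IsScalarTower.algebraMap_apply, f.commutes, g.commutes]

/-! ### Transition maps -/

/-- The inverted element of a smaller stratum stays invertible: `Γ(Z(E₁, c|E₁)) → Γ(Z(E₂, c))`.
[cite: StacksProject, Tag 096V] -/
noncomputable def strRingMap {E₁ E₂ : Finset A} (h : E₁ ⊆ E₂) (c : E₂ → Bool) :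
    StrRing E₁ (c ∘ incl h) →ₐ[A] StrRing E₂ c :=
  IsLocalization.liftAlgHom
    (M := Submonoid.powers (Ideal.Quotient.mk (strIdeal E₁ (c ∘ incl h)) (strElem E₁ (c ∘ incl h))))
    (f := (IsScalarTower.toAlgHom A (A ⧸ strIdeal E₂ c) (StrRing E₂ c)).comp
      (Ideal.Quotient.factorₐ A (strIdeal_mono h c)))
    (by
      rintro ⟨_, n, rfl⟩
      rw [map_pow]
      refine IsUnit.pow n ?_
      change IsUnit (algebraMap (A ⧸ strIdeal E₂ c) (StrRing E₂ c)
        (Ideal.Quotient.factorₐ A (strIdeal_mono h c)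
          (Ideal.Quotient.mk (strIdeal E₁ (c ∘ incl h)) (strElem E₁ (c ∘ incl h)))))
      rw [Ideal.Quotient.factorₐ_apply_mk]
      exact isUnit_of_dvd_unit
        (map_dvd _ (map_dvd (Ideal.Quotient.mk (strIdeal E₂ c)) (strElem_dvd h c)))
        (IsLocalization.Away.algebraMap_isUnit _))

/-- The multiplicative sets grow along `E₁ ⊆ E₂`. [cite: StacksProject, Tag 096V] -/
theorem clSubmonoid_mono {E₁ E₂ : Finset A} (h : E₁ ⊆ E₂) (c : E₂ → Bool) :
    clSubmonoid E₁ (c ∘ incl h) ≤ clSubmonoid E₂ c := by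
  intro s hs
  rw [mem_clSubmonoid] at hs ⊢
  have := hs.map (strRingMap h c)
  rwa [AlgHom.commutes] at this

/-- The transition map `A~_{Z(E₁, c|E₁)} → A~_{Z(E₂, c)}` ("there is a unique `A`-algebra map").
[cite: StacksProject, Tag 096V] -/
noncomputable def strLocMap {E₁ E₂ : Finset A} (h : E₁ ⊆ E₂) (c : E₂ → Bool) :
    StrLoc E₁ (c ∘ incl h) →ₐ[A] StrLoc E₂ c :=
  IsLocalization.liftAlgHom (M := clSubmonoid E₁ (c ∘ incl h)) (f := Algebra.ofId A (StrLoc E₂ c))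
    fun s => IsLocalization.map_units (StrLoc E₂ c) ⟨s.1, clSubmonoid_mono h c s.2⟩

/-! ### The stages and the two directed systems -/

/-- The stage `A_E = ∏_c S_{E,c}⁻¹ A`. [cite: StacksProject, Tag 096V] -/
abbrev ClStage (E : Finset A) : Type u := ∀ c : E → Bool, StrLoc E c

/-- The stage `∏_c Γ(Z(E,c), 𝒪)` of the constructible quotient. [cite: StacksProject, Tag 0975] -/
abbrev CqStage (E : Finset A) : Type u := ∀ c : E → Bool, StrRing E c

/-- The transition maps `A_{E₁} → A_{E₂}`: the component at `c` comes from the component at the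
restricted pattern `c|E₁`. [cite: StacksProject, Tag 096V] -/
noncomputable def clTransition (E₁ E₂ : Finset A) (h : E₁ ≤ E₂) : ClStage E₁ →ₐ[A] ClStage E₂ :=
  AlgHom.pi fun c => (strLocMap h c).comp (Pi.evalAlgHom A (fun c' => StrLoc E₁ c') (c ∘ incl h))

/-- The transition maps of the constructible quotient. [cite: StacksProject, Tag 0975] -/
noncomputable def cqTransition (E₁ E₂ : Finset A) (h : E₁ ≤ E₂) : CqStage E₁ →ₐ[A] CqStage E₂ :=
  AlgHom.pi fun c => (strRingMap h c).comp (Pi.evalAlgHom A (fun c' => StrRing E₁ c') (c ∘ incl h))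

/-- `clTransition` componentwise. [folklore] -/
theorem clTransition_apply {E₁ E₂ : Finset A} (h : E₁ ≤ E₂) (x : ClStage E₁) (c : E₂ → Bool) :
    clTransition E₁ E₂ h x c = strLocMap h c (x (c ∘ incl h)) := rfl

/-- `cqTransition` componentwise. [folklore] -/
theorem cqTransition_apply {E₁ E₂ : Finset A} (h : E₁ ≤ E₂) (x : CqStage E₁) (c : E₂ → Bool) :
    cqTransition E₁ E₂ h x c = strRingMap h c (x (c ∘ incl h)) := rfl

omit [CommRing A] in
/-- Restriction of sign patterns is strictly functorial. [folklore] -/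
theorem comp_incl {E₁ E₂ E₃ : Finset A} (h₁₂ : E₁ ⊆ E₂) (h₂₃ : E₂ ⊆ E₃) (c : E₃ → Bool) :
    (c ∘ incl h₂₃) ∘ incl h₁₂ = c ∘ incl (h₁₂.trans h₂₃) := rfl

/-- `clTransition` along a composite inclusion, componentwise. [folklore] -/
theorem clTransition_apply' {E₁ E₂ E₃ : Finset A} (h₁₂ : E₁ ≤ E₂) (h₂₃ : E₂ ≤ E₃)
    (x : ClStage E₁) (c : E₃ → Bool) :
    clTransition E₁ E₃ (h₁₂.trans h₂₃) x c =
      strLocMap (h₁₂.trans h₂₃) c (x ((c ∘ incl h₂₃) ∘ incl h₁₂)) := rfl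

/-- `cqTransition` along a composite inclusion, componentwise. [folklore] -/
theorem cqTransition_apply' {E₁ E₂ E₃ : Finset A} (h₁₂ : E₁ ≤ E₂) (h₂₃ : E₂ ≤ E₃)
    (x : CqStage E₁) (c : E₃ → Bool) :
    cqTransition E₁ E₃ (h₁₂.trans h₂₃) x c =
      strRingMap (h₁₂.trans h₂₃) c (x ((c ∘ incl h₂₃) ∘ incl h₁₂)) := rfl

/-- Transitivity of the transition maps of the strata local rings. [folklore] -/
theorem strLocMap_comp {E₁ E₂ E₃ : Finset A} (h₁₂ : E₁ ⊆ E₂) (h₂₃ : E₂ ⊆ E₃) (c : E₃ → Bool) :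
    (strLocMap h₂₃ c).comp (strLocMap h₁₂ (c ∘ incl h₂₃)) = strLocMap (h₁₂.trans h₂₃) c :=
  algHom_ext_of_isLocalization (S := clSubmonoid E₁ ((c ∘ incl h₂₃) ∘ incl h₁₂)) _ _

/-- The transition map along `E ⊆ E` is the identity. [folklore] -/
theorem strLocMap_refl (E : Finset A) (c : E → Bool) :
    strLocMap (le_refl E) c = AlgHom.id A (StrLoc E c) :=
  algHom_ext_of_isLocalization (S := clSubmonoid E (c ∘ incl (le_refl E))) _ _

/-- Transitivity of the transition maps of the strata coordinate rings. [folklore] -/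
theorem strRingMap_comp {E₁ E₂ E₃ : Finset A} (h₁₂ : E₁ ⊆ E₂) (h₂₃ : E₂ ⊆ E₃) (c : E₃ → Bool) :
    (strRingMap h₂₃ c).comp (strRingMap h₁₂ (c ∘ incl h₂₃)) = strRingMap (h₁₂.trans h₂₃) c :=
  algHom_ext_of_isLocalization_quotient
    (S := Submonoid.powers (Ideal.Quotient.mk (strIdeal E₁ ((c ∘ incl h₂₃) ∘ incl h₁₂))
      (strElem E₁ ((c ∘ incl h₂₃) ∘ incl h₁₂)))) _ _

/-- The transition map along `E ⊆ E` is the identity. [folklore] -/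
theorem strRingMap_refl (E : Finset A) (c : E → Bool) :
    strRingMap (le_refl E) c = AlgHom.id A (StrRing E c) :=
  algHom_ext_of_isLocalization_quotient
    (S := Submonoid.powers (Ideal.Quotient.mk (strIdeal E (c ∘ incl (le_refl E)))
      (strElem E (c ∘ incl (le_refl E))))) _ _

/-- The system `(A_E)_E` is directed (restriction of sign patterns is strictly functorial and
`A`-algebra maps out of localizations are unique). [cite: StacksProject, Tag 096V] -/
instance clTransition_directedSystem :
    DirectedSystem (ClStage (A := A)) (clTransition · · ·) where
  map_self := fun E x => by
    funext c
    rw [clTransition_apply, strLocMap_refl]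
    rfl
  map_map := fun E₃ E₂ E₁ h₁₂ h₂₃ x => by
    funext c
    rw [clTransition_apply' h₁₂ h₂₃ x c, clTransition_apply h₂₃, clTransition_apply h₁₂,
      ← AlgHom.comp_apply, strLocMap_comp]
    rfl

/-- The system of the constructible quotient is directed. [cite: StacksProject, Tag 0975] -/
instance cqTransition_directedSystem :
    DirectedSystem (CqStage (A := A)) (cqTransition · · ·) where
  map_self := fun E x => by
    funext c
    rw [cqTransition_apply, strRingMap_refl]
    rfl
  map_map := fun E₃ E₂ E₁ h₁₂ h₂₃ x => by
    funext c
    rw [cqTransition_apply' h₁₂ h₂₃ x c, cqTransition_apply h₂₃, cqTransition_apply h₁₂,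
      ← AlgHom.comp_apply, strRingMap_comp]
    rfl

end CLoc

/-- **The constructible localization** `colim_E ∏_c S_{E,c}⁻¹ A` of `A` (Bhatt–Scholze's /
Stacks' w-localization `A_w`, with strata indexed by sign patterns).
[cite: StacksProject, Tag 0975] -/
abbrev CLoc : Type u := DirectLimit (CLoc.ClStage (A := A)) (CLoc.clTransition)

/-- **The constructible quotient** `colim_E ∏_c Γ(Z(E,c), 𝒪)` (the coordinate ring of the
closed points of the w-localization). [cite: StacksProject, Tag 0975] -/
abbrev CQuot : Type u := DirectLimit (CLoc.CqStage (A := A)) (CLoc.cqTransition)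

namespace CLoc

variable {A}

/-- The stage map `A_E → ∏_c Γ(Z(E,c), 𝒪)`. [cite: StacksProject, Tag 0975] -/
noncomputable def stageQuot (E : Finset A) : ClStage E →ₐ[A] CqStage E :=
  AlgHom.pi fun c => (strLocToRing E c).comp (Pi.evalAlgHom A (fun c' => StrLoc E c') c)

/-- `stageQuot` componentwise. [folklore] -/
theorem stageQuot_apply (E : Finset A) (x : ClStage E) (c : E → Bool) :
    stageQuot E x c = strLocToRing E c (x c) := rfl

/-- The stage maps are surjective. [folklore] -/
theorem stageQuot_surjective (E : Finset A) : Function.Surjective (stageQuot (A := A) E) := by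
  intro q
  choose x hx using fun c => strLocToRing_surjective E c (q c)
  exact ⟨x, funext fun c => hx c⟩

/-- Compatibility of the stage maps with the transitions. [folklore] -/
theorem stageQuot_transition {E₁ E₂ : Finset A} (h : E₁ ≤ E₂) (x : ClStage E₁) :
    stageQuot E₂ (clTransition E₁ E₂ h x) = cqTransition E₁ E₂ h (stageQuot E₁ x) := by
  funext c
  rw [stageQuot_apply, clTransition_apply, cqTransition_apply, stageQuot_apply]
  have hcomp : (strLocToRing E₂ c).comp (strLocMap h c) =
      (strRingMap h c).comp (strLocToRing E₁ (c ∘ incl h)) :=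
    algHom_ext_of_isLocalization (S := clSubmonoid E₁ (c ∘ incl h)) _ _
  have := DFunLike.congr_fun hcomp (x (c ∘ incl h))
  rw [AlgHom.comp_apply, AlgHom.comp_apply] at this
  exact this

/-- **The surjection onto the constructible quotient** `CLoc A → CQuot A`.
[cite: StacksProject, Tag 0975] -/
noncomputable def toCQuot : CLoc A →ₐ[A] CQuot A :=
  DirectLimit.Algebra.lift _ _ _ (fun E => (DirectLimit.Algebra.of _ _ E).comp (stageQuot E))
    fun E₁ E₂ h x => by
      rw [AlgHom.comp_apply, AlgHom.comp_apply, stageQuot_transition, DirectLimit.Algebra.of_f]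

/-- `toCQuot` on the stages. [folklore] -/
theorem toCQuot_of (E : Finset A) (x : ClStage E) :
    toCQuot (DirectLimit.Algebra.of _ _ E x) = DirectLimit.Algebra.of _ _ E (stageQuot E x) := rfl

/-- **`CLoc A → CQuot A` is surjective.** [cite: StacksProject, Tag 0975] -/
theorem toCQuot_surjective : Function.Surjective (toCQuot (A := A)) := by
  intro y
  induction y using DirectLimit.induction with | _ E q
  obtain ⟨x, rfl⟩ := stageQuot_surjective E q
  exact ⟨DirectLimit.Algebra.of _ _ E x, rfl⟩

variable (A) in
/-- **The ideal of the closed subscheme** `Z ⊆ Spec (CLoc A)`: the kernel of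
`CLoc A → CQuot A`. [cite: StacksProject, Tag 0975] -/
noncomputable def ideal : Ideal (CLoc A) := RingHom.ker (toCQuot (A := A))

/-- Membership in `CLoc.ideal`. [folklore] -/
theorem mem_ideal {x : CLoc A} : x ∈ ideal A ↔ toCQuot x = 0 := RingHom.mem_ker

/-! ### The constructible localization is ind-Zariski (ind-étale) -/

variable (A) in
/-- **`CLoc A` satisfies the ind-étale factorization criterion** (each stage is a finite product
of localizations of `A`). [cite: StacksProject, Tag 0975] -/
theorem factorsEtale : FactorsEtale A (CLoc A) :=
  FactorsEtale.directLimit clTransition fun E =>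
    FactorsEtale.pi _ fun c => FactorsEtale.of_isLocalization (clSubmonoid E c) (StrLoc E c)

/-! ### The constructible quotient is von Neumann regular -/

/-- Elements declared invertible are units on the stratum. [folklore] -/
theorem isUnit_algebraMap_of_mem_posPart {E : Finset A} {c : E → Bool} {a : A}
    (ha : a ∈ posPart E c) : IsUnit (algebraMap A (StrRing E c) a) := by
  rw [IsScalarTower.algebraMap_apply A (A ⧸ strIdeal E c) (StrRing E c), Ideal.Quotient.algebraMap_eq]
  exact isUnit_of_dvd_unit (map_dvd _ (map_dvd _ (Finset.dvd_prod_of_mem (fun e : A => e) ha)))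
    (IsLocalization.Away.algebraMap_isUnit (Ideal.Quotient.mk (strIdeal E c) (strElem E c)))

/-- Elements declared zero vanish on the stratum. [folklore] -/
theorem algebraMap_eq_zero_of_mem_negPart {E : Finset A} {c : E → Bool} {a : A}
    (ha : a ∈ negPart E c) : algebraMap A (StrRing E c) a = 0 := by
  rw [IsScalarTower.algebraMap_apply A (A ⧸ strIdeal E c) (StrRing E c), Ideal.Quotient.algebraMap_eq,
    Ideal.Quotient.eq_zero_iff_mem.2 (show a ∈ strIdeal E c from Ideal.subset_span ha), map_zero]

/-- An element of `A` becomes a unit or zero on every stratum of a finite set containing it.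
[cite: StacksProject, Tag 0975] -/
theorem exists_mul_mul_self_algebraMap {E : Finset A} (c : E → Bool) {a : A} (ha : a ∈ E) :
    ∃ w : StrRing E c, algebraMap A (StrRing E c) a * w * algebraMap A (StrRing E c) a =
      algebraMap A (StrRing E c) a := by
  cases hc : c ⟨a, ha⟩
  · refine ⟨0, ?_⟩
    rw [algebraMap_eq_zero_of_mem_negPart (mem_negPart.2 ⟨ha, hc⟩), mul_zero]
  · obtain ⟨u, hu⟩ := isUnit_algebraMap_of_mem_posPart (mem_posPart.2 ⟨ha, hc⟩)
    refine ⟨↑u⁻¹, ?_⟩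
    rw [← hu, Units.mul_inv, one_mul]

/-- Von Neumann regularity passes from `x` to `x · u⁻¹` for a unit `u` (commutative ring).
[folklore] -/
theorem exists_mul_mul_self_of_mul_unit {R : Type*} [CommRing R] {x z : R} {u : Rˣ}
    (hz : z * u = x) (hx : ∃ w, x * w * x = x) : ∃ w, z * w * z = z := by
  obtain ⟨w, hw⟩ := hx
  refine ⟨u * w, ?_⟩
  have hz' : z = x * ↑u⁻¹ := by rw [← hz, Units.mul_inv_cancel_right]
  rw [hz']
  have h1 : x * ↑u⁻¹ * (↑u * w) * (x * ↑u⁻¹) = x * w * x * ↑u⁻¹ * (↑u⁻¹ * ↑u) := by ring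
  rw [h1, hw, Units.inv_mul, mul_one]

variable (A) in
/-- **The constructible quotient is von Neumann regular (absolutely flat)**: every element `x`
satisfies `x = x y x` for some `y` (represent `x` on the strata of a finite `E`, enlarge `E` by the
numerators: on the finer strata each numerator is a unit or zero). Compare Stacks, Tag 0975 (4)
(the closed subscheme is reduced) and Tag 092F. [cite: StacksProject, Tag 0975] -/
theorem _root_.Literature.RingTheory.Localization.CQuot.exists_mul_mul_self_eq (x : CQuot A) :
    ∃ y, x * y * x = x := by
  classical
  induction x using DirectLimit.induction with | _ E q
  -- numerators and denominators of the components of `q`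
  have hrep : ∀ c : E → Bool, ∃ (a : A) (s : Submonoid.powers
      (Ideal.Quotient.mk (strIdeal E c) (strElem E c))),
      q c * algebraMap (A ⧸ strIdeal E c) (StrRing E c) s = algebraMap A (StrRing E c) a := by
    intro c
    obtain ⟨⟨b, s⟩, hq⟩ := IsLocalization.surj (Submonoid.powers
      (Ideal.Quotient.mk (strIdeal E c) (strElem E c))) (q c)
    obtain ⟨a, rfl⟩ := Ideal.Quotient.mk_surjective b
    refine ⟨a, s, ?_⟩
    rw [hq, IsScalarTower.algebraMap_apply A (A ⧸ strIdeal E c) (StrRing E c), Ideal.Quotient.algebraMap_eq]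
  choose a s hqs using hrep
  -- enlarge `E` by the numerators
  let E₂ : Finset A := E ∪ Finset.univ.image a
  have h : E ≤ E₂ := Finset.subset_union_left
  have ha : ∀ c, a c ∈ E₂ := fun c =>
    Finset.mem_union_right _ (Finset.mem_image_of_mem a (Finset.mem_univ c))
  -- on the finer strata, the components become von Neumann regular
  have hcomp : ∀ c₂ : E₂ → Bool, ∃ w : StrRing E₂ c₂,
      cqTransition E E₂ h q c₂ * w * cqTransition E E₂ h q c₂ = cqTransition E E₂ h q c₂ := by
    intro c₂
    rw [cqTransition_apply]
    set c : E → Bool := c₂ ∘ incl h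
    have hu : IsUnit (strRingMap h c₂ (algebraMap (A ⧸ strIdeal E c) (StrRing E c) (s c))) :=
      (IsLocalization.map_units (StrRing E c) (s c)).map _
    obtain ⟨u, hu⟩ := hu
    refine exists_mul_mul_self_of_mul_unit (u := u) (x := algebraMap A (StrRing E₂ c₂) (a c)) ?_
      (exists_mul_mul_self_algebraMap c₂ (ha c))
    rw [hu, ← map_mul, hqs c, AlgHom.commutes]
  choose w hw using hcomp
  refine ⟨DirectLimit.Algebra.of _ _ E₂ w, ?_⟩
  change DirectLimit.Algebra.of (CqStage (A := A)) cqTransition E q *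
      DirectLimit.Algebra.of (CqStage (A := A)) cqTransition E₂ w *
      DirectLimit.Algebra.of (CqStage (A := A)) cqTransition E q =
    DirectLimit.Algebra.of (CqStage (A := A)) cqTransition E q
  rw [← DirectLimit.Algebra.of_f (G := CqStage (A := A)) (f := cqTransition) h, ← map_mul, ← map_mul]
  congr 1
  funext c₂
  exact hw c₂

/-- **In a von Neumann regular commutative ring every prime ideal is maximal.**
[cite: StacksProject, Tag 092F] -/
theorem _root_.Literature.RingTheory.Localization.isMaximal_of_isPrime_of_vonNeumannRegular
    {R : Type*} [CommRing R] (h : ∀ x : R, ∃ y, x * y * x = x) (P : Ideal R) [hP : P.IsPrime] :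
    P.IsMaximal := by
  refine Ideal.Quotient.maximal_of_isField P ⟨⟨0, 1, zero_ne_one⟩, mul_comm, ?_⟩
  intro x hx
  obtain ⟨x, rfl⟩ := Ideal.Quotient.mk_surjective x
  obtain ⟨y, hy⟩ := h x
  refine ⟨Ideal.Quotient.mk P y, ?_⟩
  have h1 : Ideal.Quotient.mk P x * (Ideal.Quotient.mk P y * Ideal.Quotient.mk P x - 1) = 0 := by
    rw [mul_sub, mul_one, ← mul_assoc, ← map_mul, ← map_mul, hy, sub_self]
  rcases mul_eq_zero.1 h1 with h0 | h0
  · exact absurd h0 hx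
  · rw [mul_comm]
    exact sub_eq_zero.1 h0

variable (A) in
/-- Every prime ideal of the constructible quotient is maximal. [cite: StacksProject, Tag 0975] -/
theorem _root_.Literature.RingTheory.Localization.CQuot.isMaximal_of_isPrime (P : Ideal (CQuot A))
    [P.IsPrime] : P.IsMaximal :=
  isMaximal_of_isPrime_of_vonNeumannRegular (CQuot.exists_mul_mul_self_eq A) P

/-- **Every prime of `CLoc A` containing the ideal of the closed subscheme is maximal** (it is the
preimage of a prime of the von Neumann regular ring `CQuot A`). [cite: StacksProject, Tag 0975] -/
theorem isMaximal_of_ideal_le (P : Ideal (CLoc A)) [hP : P.IsPrime] (hle : ideal A ≤ P) :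
    P.IsMaximal := by
  have hker : RingHom.ker (toCQuot (A := A)) ≤ P := hle
  haveI : (P.map (toCQuot (A := A))).IsPrime :=
    Ideal.map_isPrime_of_surjective toCQuot_surjective hker
  haveI := CQuot.isMaximal_of_isPrime A (P.map (toCQuot (A := A)))
  have hP' : P = (P.map (toCQuot (A := A))).comap (toCQuot (A := A)) := by
    rw [Ideal.comap_map_of_surjective _ toCQuot_surjective, left_eq_sup]
    exact fun x hx => hker hx
  rw [hP']
  exact Ideal.comap_isMaximal_of_surjective _ toCQuot_surjective

/-! ### The closed subscheme surjects onto `Spec A` -/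

section Eval

variable (𝔭 : Ideal A) [𝔭.IsPrime]

/-- The sign pattern of a prime `𝔭` on `E`: invertible off `𝔭`, zero on `𝔭`. [folklore] -/
noncomputable def primePattern (E : Finset A) : E → Bool :=
  fun e => @decide (e.1 ∉ 𝔭) (Classical.dec _)

omit [𝔭.IsPrime] in
/-- The stratum ideal of the pattern of `𝔭` is contained in `𝔭`. [folklore] -/
theorem strIdeal_primePattern_le (E : Finset A) : strIdeal E (primePattern 𝔭 E) ≤ 𝔭 := by
  refine Ideal.span_le.2 fun a ha => ?_
  obtain ⟨haE, hc⟩ := mem_negPart.1 ha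
  simpa [primePattern] using hc

/-- The inverted element of the pattern of `𝔭` is not in `𝔭`. [folklore] -/
theorem strElem_primePattern_not_mem (E : Finset A) : strElem E (primePattern 𝔭 E) ∉ 𝔭 := by
  classical
  refine (Ideal.IsPrime.prod_mem_iff.not).2 ?_
  push Not
  intro a ha
  obtain ⟨haE, hc⟩ := mem_posPart.1 ha
  simpa [primePattern] using hc

/-- `Γ(Z(E, pattern of 𝔭), 𝒪) → κ(𝔭)`. [cite: StacksProject, Tag 0975] -/
noncomputable def strEval (E : Finset A) : StrRing E (primePattern 𝔭 E) →ₐ[A] 𝔭.ResidueField :=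
  IsLocalization.liftAlgHom
    (M := Submonoid.powers (Ideal.Quotient.mk (strIdeal E (primePattern 𝔭 E))
      (strElem E (primePattern 𝔭 E))))
    (f := Ideal.Quotient.liftₐ (strIdeal E (primePattern 𝔭 E)) (Algebra.ofId A 𝔭.ResidueField)
      fun a ha => Ideal.algebraMap_residueField_eq_zero.2 (strIdeal_primePattern_le 𝔭 E ha))
    (by
      rintro ⟨_, n, rfl⟩
      rw [map_pow]
      refine IsUnit.pow n (Ne.isUnit ?_)
      rw [Ideal.Quotient.liftₐ_apply, Ideal.Quotient.lift_mk]
      exact fun h0 => strElem_primePattern_not_mem 𝔭 E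
        (Ideal.algebraMap_residueField_eq_zero.1 h0))

/-- `∏_c Γ(Z(E,c), 𝒪) → κ(𝔭)` through the stratum of `𝔭`. [cite: StacksProject, Tag 0975] -/
noncomputable def cqEval (E : Finset A) : CqStage E →ₐ[A] 𝔭.ResidueField :=
  (strEval 𝔭 E).comp (Pi.evalAlgHom A (fun c => StrRing E c) (primePattern 𝔭 E))

/-- `cqEval` unfolded. [folklore] -/
theorem cqEval_apply (E : Finset A) (q : CqStage E) :
    cqEval 𝔭 E q = strEval 𝔭 E (q (primePattern 𝔭 E)) := rfl

/-- Compatibility of the evaluations with the transitions. [folklore] -/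
theorem cqEval_transition {E₁ E₂ : Finset A} (h : E₁ ≤ E₂) (q : CqStage E₁) :
    cqEval 𝔭 E₂ (cqTransition E₁ E₂ h q) = cqEval 𝔭 E₁ q := by
  rw [cqEval_apply, cqEval_apply, cqTransition_apply, ← AlgHom.comp_apply]
  have hcomp : (strEval 𝔭 E₂).comp (strRingMap h (primePattern 𝔭 E₂)) = strEval 𝔭 E₁ :=
    algHom_ext_of_isLocalization_quotient
      (S := Submonoid.powers (Ideal.Quotient.mk (strIdeal E₁ (primePattern 𝔭 E₂ ∘ incl h))
        (strElem E₁ (primePattern 𝔭 E₂ ∘ incl h)))) _ _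
  rw [hcomp]
  rfl

/-- **Evaluation at a prime** `CQuot A → κ(𝔭)`. [cite: StacksProject, Tag 0975] -/
noncomputable def evalAt : CQuot A →ₐ[A] 𝔭.ResidueField :=
  DirectLimit.Algebra.lift _ _ _ (cqEval 𝔭) fun _ _ h q => cqEval_transition 𝔭 h q

/-- **The closed subscheme of the constructible localization surjects onto `Spec A`**: every
prime `𝔭 ⊆ A` is the restriction of a prime of `CLoc A` containing `CLoc.ideal A` (the kernel of
`CLoc A → CQuot A → κ(𝔭)`). [cite: StacksProject, Tag 0975] -/
theorem exists_prime_over : ∃ P : Ideal (CLoc A), P.IsPrime ∧ ideal A ≤ P ∧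
    P.comap (algebraMap A (CLoc A)) = 𝔭 := by
  let φ : CLoc A →ₐ[A] 𝔭.ResidueField := (evalAt 𝔭).comp toCQuot
  refine ⟨RingHom.ker φ, RingHom.ker_isPrime _, ?_, ?_⟩
  · intro x hx
    rw [mem_ideal] at hx
    change φ x = 0
    rw [AlgHom.comp_apply, hx, map_zero]
  · ext x
    rw [Ideal.mem_comap, RingHom.mem_ker, AlgHom.commutes, Ideal.algebraMap_residueField_eq_zero]

end Eval

end CLoc

end Literature.RingTheory.Localization
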